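import Summits.KontsevichZagierPeriods.KontsevichZagierPeriods.Theorems.HurwitzMicroSectorsNormalFormPrincipleDilogExistsBoxAtoms
import Literature.NumberTheory.Transcendental.KZProductIdeal

/-!
# `NormalFormPrinciple` (stmt-KontsevichZagierPeriods-3869), line `SketchIdeator1` —
# M3 words-kernel capstone: the log-cube reference box and its value `(log 2)³`

Pure proof file (registered sub-goal `m3x_exists_logCubeRef`, lead seat c9; `--supports` the crux).
The extended kernel capstone of the layer `M3` shows that Conjecture 1 of Kontsevich–Zagier holds
on the subgroup of `KZ.FormalRep` generated by the eleven dimension-three box families, the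
log-cube box and the sixteen word families of the level-2 weight-3 descent, conditionally on the
`ℚ`-linear independence of `ζ(3)`, `π² log 2` and `(log 2)³`: every generator reduces, after
multiplication by `24`, to `α•Z + β•Q + γ•B3` modulo `KZ.relations`, and the assembly then
EVALUATES. This file supplies the third reference representation the assembly starts from, as an
honest integral representation of the Kontsevich–Zagier calculus
(`Literature.NumberTheory.Transcendental.KZ.IntegralRep 3`) on the open unit box `□³ = (0,1)³`:

* the log-cube box `B3 = [□³, 1/((1 + x₀)(1 + x₁)(1 + x₂))]` together with its VALUE
  `B3.value = (log 2)³`.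

The value is a product integral: Lebesgue measure restricted to the box is the three-fold product
of Lebesgue measure restricted to `(0,1)` (`Beukers.volume_restrict_cube`), the integrand is the
product `∏ᵢ 1/(1 + xᵢ)` of one-variable functions, so Fubini
(`MeasureTheory.integral_fintype_prod_eq_pow`) gives `(∫₀¹ dx/(1 + x))³ = (log 2)³`
(translation `x ↦ 1 + x` and `∫₁² dx/x = log 2`). Semialgebraicity of the integrand is
`isSemialgebraicFunOn_aeval_div_aeval` (a quotient of `ℚ`-polynomials with non-vanishing
denominator); the box is `KZ.isSemialgebraic_box`; the integrand is bounded and continuous on the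
compact cube `[0,1]³`, hence absolutely integrable on `□³`.

Sources: M. Kontsevich, D. Zagier, *Periods* (2001), §1.1 (`log 2` as a period), §1.2, §4.1
(Fubini). No definitions are introduced.
-/

noncomputable section

open MeasureTheory Set
open Literature.NumberTheory.Transcendental Literature.NumberTheory.Transcendental.KZ
open Literature.ModelTheory.ExponentialFields (IsSemialgebraic)

namespace Summit.KontsevichZagierPeriods.HurwitzMicroSectors.NormalFormPrinciple.PiBox.M3

/-! ## The one-dimensional value `∫₀¹ dx/(1 + x) = log 2` -/

/-- **`∫₀¹ dx/(1 + x) = log 2`** over the open unit interval (the translation `x ↦ 1 + x` and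
`∫₁² dx/x = log (2/1) = log 2`). [cite: KontsevichZagier2001, §1.1] -/
theorem m3p_setIntegral_Ioo_one_div_one_add :
    ∫ t in Set.Ioo (0:ℝ) 1, 1 / (1 + t) = Real.log 2 := by
  rw [← integral_Ioc_eq_integral_Ioo, ← intervalIntegral.integral_of_le zero_le_one]
  have h2 := intervalIntegral.integral_comp_add_left (fun t : ℝ => 1 / t) (a := 0) (b := 1) (1:ℝ)
  simp only [add_zero, one_add_one_eq_two] at h2
  rw [h2, integral_one_div_of_pos one_pos two_pos, div_one]

/-! ## The value of the log-cube box -/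

/-- **`∫∫∫_{(0,1)³} dx/((1 + x₀)(1 + x₁)(1 + x₂)) = (log 2)³`**: Lebesgue measure restricted to the
open unit box of `ℝ³` is the three-fold product of Lebesgue measure restricted to `(0,1)`
(`Beukers.volume_restrict_cube`), the integrand is the product `∏ᵢ 1/(1 + xᵢ)`, and Fubini for a
power of a one-variable integral (`integral_fintype_prod_eq_pow`) gives `(∫₀¹ dx/(1 + x))³`.
[cite: KontsevichZagier2001, §4.1] -/
theorem m3p_setIntegral_box_logCube :
    ∫ x in {x : Fin 3 → ℝ | ∀ i, x i ∈ Set.Ioo (0:ℝ) 1}, 1 / ((1 + x 0) * (1 + x 1) * (1 + x 2)) =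
      Real.log 2 ^ 3 := by
  rw [Beukers.volume_restrict_cube 3]
  have h1 := integral_fintype_prod_eq_pow (ι := Fin 3)
    (μ := (volume : Measure ℝ).restrict (Set.Ioo (0:ℝ) 1)) (fun t : ℝ => 1 / (1 + t))
  simp only [Fin.prod_univ_three, one_div_mul_one_div, Fintype.card_fin] at h1
  rw [h1, m3p_setIntegral_Ioo_one_div_one_add]

/-! ## The registered sub-goal -/

/-- **Stub X1 (`m3x_exists_logCubeRef`; registered sub-goal of stmt-KontsevichZagierPeriods-3869,
line `SketchIdeator1`, layer `M3` words-kernel capstone).** The third reference representation of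
the extended kernel capstone with its VALUE: the log-cube box
`B3 = [(0,1)³, 1/((1 + x₀)(1 + x₁)(1 + x₂))]` (domain literally the open unit box, integrand
literally the displayed function: a quotient of `ℚ`-polynomials with denominator `≥ 1` on the
box, bounded and continuous on the compact cube `[0,1]³`, hence absolutely integrable) with
`B3.value = (log 2)³` (a product integral, `(∫₀¹ dx/(1 + x))³`).
[cite: KontsevichZagier2001, §1.1] -/
theorem m3x_exists_logCubeRef :
    ∃ B3 : IntegralRep 3, B3.domain = {x | ∀ i, x i ∈ Set.Ioo (0:ℝ) 1} ∧
      (B3.integrand = fun x => 1 / ((1 + x 0) * (1 + x 1) * (1 + x 2))) ∧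
      B3.value = Real.log 2 ^ 3 := by
  have hB := isSemialgebraic_box 3
  have hsa : IsSemialgebraicFunOn ℚ {x : Fin 3 → ℝ | ∀ i, x i ∈ Set.Ioo (0:ℝ) 1}
      (fun x => 1 / ((1 + x 0) * (1 + x 1) * (1 + x 2))) := by
    refine (isSemialgebraicFunOn_aeval_div_aeval hB (1 : MvPolynomial (Fin 3) ℚ)
      ((1 + MvPolynomial.X 0) * (1 + MvPolynomial.X 1) * (1 + MvPolynomial.X 2))
      fun x hx => ?_).congr fun x _ => ?_
    · simp only [map_add, map_one, map_mul, MvPolynomial.aeval_X]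
      have h0 := (hx 0).1
      have h1 := (hx 1).1
      have h2 := (hx 2).1
      positivity
    · simp only [map_add, map_one, map_mul, MvPolynomial.aeval_X]
  have hint : IntegrableOn (fun x : Fin 3 → ℝ => 1 / ((1 + x 0) * (1 + x 1) * (1 + x 2)))
      {x : Fin 3 → ℝ | ∀ i, x i ∈ Set.Ioo (0:ℝ) 1} := by
    have hc : ContinuousOn (fun x : Fin 3 → ℝ => 1 / ((1 + x 0) * (1 + x 1) * (1 + x 2)))
        (Set.Icc 0 1) :=
      continuousOn_const.div (by fun_prop) fun x hx => by
        have h0 : (0:ℝ) ≤ x 0 := hx.1 0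
        have h1 : (0:ℝ) ≤ x 1 := hx.1 1
        have h2 : (0:ℝ) ≤ x 2 := hx.1 2
        positivity
    exact (hc.integrableOn_compact isCompact_Icc).mono_set
      fun x hx => ⟨fun i => (hx i).1.le, fun i => (hx i).2.le⟩
  refine ⟨⟨_, _, hB, hsa, hint⟩, rfl, rfl, ?_⟩
  rw [IntegralRep.value]
  exact m3p_setIntegral_box_logCube

end Summit.KontsevichZagierPeriods.HurwitzMicroSectors.NormalFormPrinciple.PiBox.M3
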